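import Summits.MatrixMultiplication.OmegaCensus.Dicyclic40Law
import HarnessLib

/-!
# `β(C₂ × G) = 2β(G)` for dicyclic-type `G` attaining the `|A| ≡ 2 (mod 3)` law, when `(ℤ₂ × A)/⟨(0,c₀)⟩` is not cyclic

ω-census, family (b3).  Framing: lottery ticket; floor = certified bounds/negative ranges.

Let `G = G(A, c₀)` be of dicyclic type (`c₀ ≠ 0`) with `|A| ≡ 2 (mod 3)` and a TPP triple attaining the dicyclic law
`3V + 16 = 8|A|` (e.g. `Q_{4n}`, `n ≡ 1 (mod 3)`; `C₂ × G'` for law-attaining `G'` of the `≡ 1` type, `C2DicyclicQuotCyclicLaw.lean`).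
`C₂ × G = G(ℤ₂ × A, (0,c₀))` has `|A'| = 2|A| ≡ 1 (mod 3)`; if its quotient `(ℤ₂ × A)/⟨(0,c₀)⟩ ≅ ℤ₂ × A/⟨c₀⟩` is NOT cyclic
(i.e. `A/⟨c₀⟩` is non-cyclic or of even order) and `|A| ≥ 26`, the P3 exclusion gives `3V' + 32 ≤ 16|A|`
(`tpp_volume_dicyclic_quot_noncyclic_le`), which `(C₂, 1, 1) ×` the law triple attains:
**`c2_dicyclic_law_of_mod_two_law`: β(C₂ × G) = (16|A| − 32)/3 = 2β(G)`.**  (If instead `A/⟨c₀⟩` is cyclic of odd order, the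
quotient of `C₂ × G` is cyclic and `β(C₂ × G) = (16|A| − 8)/3 > 2β(G)` by `dicyclic_type_mod_one_law_iff` — the `C₂ × Q_{4m}`,
`m ≡ 1 (mod 6)` phenomenon.)
-/

namespace Summit.MatrixMultiplication.OmegaCensus

open Literature.Combinatorics.Additive Finset
open Summit.MatrixMultiplication.MatrixMultiplication.Theorems.JuntaBranch.Planting (tpp_product)

section C2G2

variable {A : Type*} [AddCommGroup A] [Fintype A] [DecidableEq A] {G : Type} [Group G] [DecidableEq G]
  {ρ τ : A → G} {c₀ : A}

/-- **`β(C₂ × G) = (16|A| − 32)/3 = 2β(G)`** for dicyclic-type `G` with a `3V + 16 = 8|A|` triple (`|A| ≡ 2 (mod 3)`, `|A| ≥ 26`)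
whose double `C₂ × G` has a non-cyclic quotient. [folklore] -/
theorem c2_dicyclic_law_of_mod_two_law
    (hρρ : ∀ a b, ρ a * ρ b = ρ (a + b)) (hρτ : ∀ a b, ρ a * τ b = τ (b - a))
    (hτρ : ∀ a b, τ a * ρ b = τ (a + b)) (hττ : ∀ a b, τ a * τ b = ρ (c₀ + b - a)) (hc₀ : c₀ ≠ 0)
    (hρ : Function.Injective ρ) (hτ : Function.Injective τ) (hne : ∀ a b, ρ a ≠ τ b)
    (hsurj : ∀ g, (∃ a, ρ a = g) ∨ (∃ a, τ a = g)) (hmod : Fintype.card A % 3 = 2) (hA : 26 ≤ Fintype.card A)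
    (hnq : ¬ ∃ g : ZMod 2 × A, ∀ x, x ∈ AddSubgroup.zmultiples g ∨
      x + ((0 : ZMod 2), c₀) ∈ AddSubgroup.zmultiples g)
    (hex : ∃ S T U : Finset G, TripleProductProperty S T U ∧ 3 * (S.card * T.card * U.card) + 16 = 8 * Fintype.card A) :
    (∀ S T U : Finset (Multiplicative (ZMod 2) × G), TripleProductProperty S T U →
        3 * (S.card * T.card * U.card) + 32 ≤ 16 * Fintype.card A) ∧
    ∃ S T U : Finset (Multiplicative (ZMod 2) × G), TripleProductProperty S T U ∧
      3 * (S.card * T.card * U.card) + 32 = 16 * Fintype.card A := by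
  refine ⟨fun S T U h => ?_, ?_⟩
  · refine c2_product_presentation hρρ hρτ hτρ hττ hρ hτ hne hsurj
      fun ρ' τ' c₀' hρρ' hρτ' hτρ' hττ' hρ' hτ' hne' hsurj' hc' => ?_
    subst hc'
    have hc₀' : (((0 : ZMod 2), c₀) : ZMod 2 × A) ≠ 0 := fun h0 => hc₀ (congrArg Prod.snd h0)
    have hcard : Fintype.card (ZMod 2 × A) = 2 * Fintype.card A := by rw [Fintype.card_prod, ZMod.card]
    have key := tpp_volume_dicyclic_quot_noncyclic_le hρρ' hρτ' hτρ' hττ' hc₀' hnq hρ' hτ' hne' hsurj'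
      (by rw [hcard]; omega) (by rw [hcard]; omega) h
    rw [hcard] at key
    omega
  · obtain ⟨S, T, U, h, hvol⟩ := hex
    refine ⟨univ ×ˢ S, {1} ×ˢ T, {1} ×ˢ U, tpp_product tpp_univ_one_one h, ?_⟩
    simp only [card_product, card_univ, card_singleton, Fintype.card_multiplicative, ZMod.card]
    have e : 2 * S.card * (1 * T.card) * (1 * U.card) = 2 * (S.card * T.card * U.card) := by ring
    rw [e]
    omega

end C2G2

end Summit.MatrixMultiplication.OmegaCensus
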